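/-
COR-CM (cell pub-hodgecm2, stage 2 of the Hodge ladder) — count-neutral KERNEL COMBINATORICS «β resp. β − 2 faces for every Galois CM field of quartic
inversion type over ℤ/m» (seat prover-pub-hodgecm2-b23-g44-0, binder prover b23, gen 44; claim QUARTIC-INVERSION, HOME/INBOX.md l.12829).
Theorems only; no geometry beyond the tree's `Face` / `faceOfG`, no `Universe` field touched, no named fact, nothing asserted; the lane
`Census/QuarticInversion*` (this seat), the generic transfer `CorCM/FaceGenerationTransfer.lean` and the INT2-GEN socket (`CorCM/FacePeriodsGeneratingSet.lean`)
are used BY NAME; `Interfaces.lean` (C1), every E term, B01, `Transposition/*`, `PortJoin/*` are untouched.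
HONEST FRAMING (COORDINATOR RULING — HODGE FRAMING CORRECTION, 2026-08-21T11:55:35Z): `HC_CM` is NOT proved, here or anywhere in the tree;
this file produces no period and proves no face period for any field; its `HodgeConjectureFor` statements are CONDITIONAL on face periods.
T5: n/a-class — the only Prop hypothesis binders displayed are the quartic inversion datum, `m` odd, `3 ≤ m` and INT2-GEN's period hypothesis on the
produced face set (§3); no named-fact / conjecture-def binder; checker: self (prover-pub-hodgecm2-b23-g44-0), 2026-08-24.
-/
import Summits.HodgeConjecture.CorCM.Census.QuarticInversionCyclic
import Summits.HodgeConjecture.CorCM.Census.QuarticInversionExhaust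
import Summits.HodgeConjecture.CorCM.FaceGenerationTransfer
import Summits.HodgeConjecture.CorCM.FaceCensusOddSliceTransport
import HarnessLib

/-!
# Galois CM fields of quartic inversion type over `ℤ/m`: EXACTLY `β` (dicyclic class) resp. `β − 2` (dihedral class) generating rank-four faces

Let `F` be a Galois CM field whose Galois translates `GalT F` carry a QUARTIC INVERSION DATUM over `ℤ/m`, `m` odd `≥ 3`
(`Census/QuarticInversionDictionary.lean`, `QuarticInversion.Datum (GalT F) conjT (ZMod m) ζ`): an embedded copy `ι : ℤ/2 × ℤ/m ↪ GalT F` with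
`ι (1,0) = conjT`, a translate `y` inverting it with `y² = ι (ζ, 0)`, a translate `t` centralising it with `t² = conjT` and `y t = conjT·t·y`, the four
cosets exhausting `GalT F` — i.e. `Gal(F/ℚ) ≅ Dic(ℤ/4 × ℤ/m) = Dic(ℤ/4m)` for `ζ = 1` (complex conjugation the square of the elements of order `4`
outside the cyclic part; e.g. `Dic₆` of order `24`) and `Gal(F/ℚ) ≅ D(ℤ/4m) = D_{4m}` for `ζ = 0` (complex conjugation `= r^{2m}`, the square of the
rotation of order `4`; e.g. `D₁₂`).  `[F:ℚ] = 8m ≥ 24`.  Complex conjugation is not complemented and these groups carry no dicyclic datum over an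
abelian group containing `c` as `x²` with `x` inverting (`ζ = 0`) — none of `CorCM/FaceAbelian*`, `CorCM/FaceComplement*`, `CorCM/FaceCyclicGeneration`,
`CorCM/FaceQuarticTwist*`, `CorCM/FaceDicyclicTwist*` covers both classes.  Write `β(F) = #Block conjT`.

* §1 **`isLeast_card_faces_hgen_of_quartic_one`** / **`…_zero`**: for every base embedding `σ₀` the least size of a finite set `𝒮` of rank-four faces of
  `F` satisfying INT2-GEN's generation binder `hgen(𝒮, σ₀)` is **EXACTLY `β(F)`** (`ζ = 1`) resp. **EXACTLY `β(F) − 2`** (`ζ = 0`).  Existence is this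
  seat's generation theorem (`Census/QuarticInversionGeneration.lean`: one potential-reducing face per non-residual block and the ten closing faces
  `B1`, through the `32m + 8` pair-odd product functionals, the key lemma and the index-one closing lattice) transported to `CMF (GalT F) conjT`
  (`Census/QuarticInversionTransport.lean`, `…Law.lean`, `…Cyclic.lean`); the floors are lit-andre-3's type-stabiliser closed form with seat b09's
  coinvariant floor (`Census/QuarticInversionStabiliser.lean`: `φ₂ = β` resp. `φ₂ = β − 2`); both are carried to the field by
  `CorCM/FaceGenerationTransfer.lean` (`FaceTransfer.isLeast_card_faces_hgen_of_intrinsic`).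
* §1 (cont.) the first rows: group `Dic₆` (degree `24`): EXACTLY `172` faces; group `D₁₂` (degree `24`, `c = r⁶`): EXACTLY `202`
  (`Census/QuarticInversionBlockCount.lean`: `β = 172, 204`).
* §2 the degree (`finrank_eq_eight_mul`) and the datum from the automorphism group (`exists_datum_of_aut`).
* §3 **`hodgeConjectureFor_of_quartic_one/zero_of_exists_facePeriod`** (INT2-GEN socket BY NAME): a face set with `|𝒮| = β(F)` resp. `|𝒮| + 2 = β(F)`
  EXISTS whose periods on the universe of record give the Hodge conjecture for every abelian variety dominated by a product of CM abelian varieties with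
  CM by subfields of `F` — CONDITIONAL on those periods; `HC_CM` is NOT proved.

References: [cite: Pohlmann1968, Thm. 1]; [cite: Milne1999LefschetzClasses, Thm. 3.2, Prop. 2.1]; [cite: Shimura1998, §6.2 Theorem 3 and §6.1
Corollary of Theorem 2 (pp. 41–43), §8.1 (p. 62)]; [cite: MumfordAV1970, §19 Thm. 1 and p. 169].
-/

noncomputable section

open CategoryTheory NumberField NumberField.ComplexEmbedding
open Literature.AlgebraicGeometry Literature.AlgebraicGeometry.Motives Literature.AlgebraicGeometry.HodgeTheory
open Literature.AlgebraicGeometry.ComplexMultiplication Literature.AlgebraicGeometry.Milne1999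
open Literature.NumberTheory.Automorphic
open Literature.NumberTheory.Automorphic.PicardCM
open Summit.HodgeConjecture.CorCM.Domination

namespace Summit.HodgeConjecture.CorCM.FaceQuarticInversion

open Summit.HodgeConjecture.CorCM.Prior.AllgGroup.RfwfAllgGroup
open Summit.HodgeConjecture.CorCM.Census.BlockParity
open Summit.HodgeConjecture.CorCM.Census.Coinvariant
open Summit.HodgeConjecture.CorCM.Census
open Summit.HodgeConjecture.CorCM.FaceCensus.OddSlice (galTOfAut galTOfAut_mul galTOfAut_conjAut)

/-! ## §1 Quartic inversion datum on the Galois translates: exactly `β(F)` resp. `β(F) − 2` generating faces -/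

section Field

variable {F : Type} [Field F] [NumberField F] {m : ℕ} [NeZero m]

/-- **EVERY GALOIS CM FIELD OF DICYCLIC QUARTIC TYPE (`ζ = 1`, `Gal ≅ Dic(ℤ/4m)`, `m` odd `≥ 3`) HAS `β` GENERATING FACES, AND NONE FEWER.**
[folklore] -/
theorem isLeast_card_faces_hgen_of_quartic_one [IsCMField F] [IsGalois ℚ F] (D : QuarticInversion.Datum (GalT F) conjT (ZMod m) 1)
    (hm : Odd m) (h3 : 3 ≤ m) (σ₀ : F →+* ℂ) :
    IsLeast {n : ℕ | ∃ 𝒮 : Finset (Face F), 𝒮.card = n ∧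
      ∀ f : Face F, lefChar f.corner (fun _ => ({σ₀} : Finset (F →+* ℂ))) ∈ AddSubgroup.closure
        {a : Asym F | ∃ g ∈ (𝒮 : Set (Face F)), ∃ σ : F →+* ℂ, a = lefChar g.corner (fun _ => ({σ} : Finset (F →+* ℂ)))}}
      (Fintype.card (Block (conjT : GalT F))) := by
  have hA : Odd (Fintype.card (ZMod m)) := by rw [ZMod.card]; exact hm
  have hB : ∀ s : ZMod m, ¬ 4 ∣ addOrderOf s := ClockTypes.not_four_dvd_addOrderOf_of_odd hA
  refine FaceTransfer.isLeast_card_faces_hgen_of_intrinsic _ ?_ (fun S₀ hS₀ hS => ?_) σ₀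
  · obtain ⟨S, hS, hcard, hgen⟩ := QuarticInversion.exists_gfaces_generate_card_eq_cyclic_one D conjT_mul_self hm h3
    exact ⟨S, hS, hcard.le, hgen⟩
  · exact QuarticInversion.card_block_le_card_of_one D hB conjT_mul_self S₀ hS₀
      (fun y hy => hS (gfaceSet_subset_hodgeSpan conjT conjT_mul_self hy))

/-- **EVERY GALOIS CM FIELD OF DIHEDRAL QUARTIC TYPE (`ζ = 0`, `Gal ≅ D_{4m}`, `c = r^{2m}`, `m` odd `≥ 3`) HAS `β − 2` GENERATING FACES, AND NONE
FEWER.** [folklore] -/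
theorem isLeast_card_faces_hgen_of_quartic_zero [IsCMField F] [IsGalois ℚ F] (D : QuarticInversion.Datum (GalT F) conjT (ZMod m) 0)
    (hm : Odd m) (h3 : 3 ≤ m) (σ₀ : F →+* ℂ) :
    IsLeast {n : ℕ | ∃ 𝒮 : Finset (Face F), 𝒮.card = n ∧
      ∀ f : Face F, lefChar f.corner (fun _ => ({σ₀} : Finset (F →+* ℂ))) ∈ AddSubgroup.closure
        {a : Asym F | ∃ g ∈ (𝒮 : Set (Face F)), ∃ σ : F →+* ℂ, a = lefChar g.corner (fun _ => ({σ} : Finset (F →+* ℂ)))}}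
      (Fintype.card (Block (conjT : GalT F)) - 2) := by
  refine FaceTransfer.isLeast_card_faces_hgen_of_intrinsic _ ?_ (fun S₀ hS₀ hS => ?_) σ₀
  · obtain ⟨S, hS, hcard, hgen⟩ := QuarticInversion.exists_gfaces_generate_card_eq_cyclic_zero D conjT_mul_self hm h3
    exact ⟨S, hS, hcard.le, hgen⟩
  · have h := QuarticInversion.card_block_le_card_add_two_of_zero D conjT_mul_self S₀ hS₀
      (fun y hy => hS (gfaceSet_subset_hodgeSpan conjT conjT_mul_self hy))
    omega

/-- **Existence with the exact count, `ζ = 1`**: a face set `𝒮` with `|𝒮| = β(F)` and `hgen(𝒮, σ₀)`. [folklore] -/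
theorem exists_faces_hgen_of_quartic_one [IsCMField F] [IsGalois ℚ F] (D : QuarticInversion.Datum (GalT F) conjT (ZMod m) 1)
    (hm : Odd m) (h3 : 3 ≤ m) (σ₀ : F →+* ℂ) :
    ∃ 𝒮 : Finset (Face F), 𝒮.card = Fintype.card (Block (conjT : GalT F)) ∧
      ∀ f : Face F, lefChar f.corner (fun _ => ({σ₀} : Finset (F →+* ℂ))) ∈ AddSubgroup.closure
        {a : Asym F | ∃ g ∈ (𝒮 : Set (Face F)), ∃ σ : F →+* ℂ, a = lefChar g.corner (fun _ => ({σ} : Finset (F →+* ℂ)))} :=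
  (isLeast_card_faces_hgen_of_quartic_one D hm h3 σ₀).1

/-- **Existence with the exact count, `ζ = 0`**: a face set `𝒮` with `|𝒮| + 2 = β(F)` and `hgen(𝒮, σ₀)`. [folklore] -/
theorem exists_faces_hgen_of_quartic_zero [IsCMField F] [IsGalois ℚ F] (D : QuarticInversion.Datum (GalT F) conjT (ZMod m) 0)
    (hm : Odd m) (h3 : 3 ≤ m) (σ₀ : F →+* ℂ) :
    ∃ 𝒮 : Finset (Face F), 𝒮.card + 2 = Fintype.card (Block (conjT : GalT F)) ∧
      ∀ f : Face F, lefChar f.corner (fun _ => ({σ₀} : Finset (F →+* ℂ))) ∈ AddSubgroup.closure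
        {a : Asym F | ∃ g ∈ (𝒮 : Set (Face F)), ∃ σ : F →+* ℂ, a = lefChar g.corner (fun _ => ({σ} : Finset (F →+* ℂ)))} := by
  obtain ⟨⟨𝒮, hcard, hgen⟩, -⟩ := isLeast_card_faces_hgen_of_quartic_zero D hm h3 σ₀
  obtain ⟨S, -, hS2, -⟩ := QuarticInversion.exists_gfaces_generate_zero D conjT_mul_self (by rw [ZMod.card]; exact hm)
    (by rw [ZMod.card]; exact h3) (QuarticInversion.exists_slot_datum m hm h3)
  exact ⟨𝒮, by omega, hgen⟩

/-- **Group `Dic₆` (degree `24`, `m = 3`, `ζ = 1`): EXACTLY `172` generating faces** (`β = 172`). [folklore] -/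
theorem isLeast_card_faces_hgen_oneHundredSeventyTwo [IsCMField F] [IsGalois ℚ F] (D : QuarticInversion.Datum (GalT F) conjT (ZMod m) 1)
    (h3 : m = 3) (σ₀ : F →+* ℂ) :
    IsLeast {n : ℕ | ∃ 𝒮 : Finset (Face F), 𝒮.card = n ∧
      ∀ f : Face F, lefChar f.corner (fun _ => ({σ₀} : Finset (F →+* ℂ))) ∈ AddSubgroup.closure
        {a : Asym F | ∃ g ∈ (𝒮 : Set (Face F)), ∃ σ : F →+* ℂ, a = lefChar g.corner (fun _ => ({σ} : Finset (F →+* ℂ)))}} 172 := by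
  have h := isLeast_card_faces_hgen_of_quartic_one D (by rw [h3]; exact ⟨1, rfl⟩) (by omega) σ₀
  rwa [QuarticInversion.card_block_eq_oneHundredSeventyTwo D conjT_mul_self (by rw [ZMod.card, h3])] at h

/-- **Group `D₁₂` with `c = r⁶` (degree `24`, `m = 3`, `ζ = 0`): EXACTLY `202` generating faces** (`β = 204`). [folklore] -/
theorem isLeast_card_faces_hgen_twoHundredTwo [IsCMField F] [IsGalois ℚ F] (D : QuarticInversion.Datum (GalT F) conjT (ZMod m) 0)
    (h3 : m = 3) (σ₀ : F →+* ℂ) :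
    IsLeast {n : ℕ | ∃ 𝒮 : Finset (Face F), 𝒮.card = n ∧
      ∀ f : Face F, lefChar f.corner (fun _ => ({σ₀} : Finset (F →+* ℂ))) ∈ AddSubgroup.closure
        {a : Asym F | ∃ g ∈ (𝒮 : Set (Face F)), ∃ σ : F →+* ℂ, a = lefChar g.corner (fun _ => ({σ} : Finset (F →+* ℂ)))}} 202 := by
  have h := isLeast_card_faces_hgen_of_quartic_zero D (by rw [h3]; exact ⟨1, rfl⟩) (by omega) σ₀
  rwa [QuarticInversion.card_block_eq_twoHundredFour D conjT_mul_self (by rw [ZMod.card, h3])] at h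

/-! ## §2 The degree; the datum from the automorphism group -/

/-- **The degree of a quartic-inversion-type field over `ℤ/m` is `8m`.** [folklore] -/
theorem finrank_eq_eight_mul [IsGalois ℚ F] {ζ : ZMod 2} (D : QuarticInversion.Datum (GalT F) conjT (ZMod m) ζ) :
    Module.finrank ℚ F = 8 * m := by
  rw [← FaceCensus.card_galT, QuarticInversion.card_eq_eight_mul D, ZMod.card]

/-- Such a field has degree at least `24` when `m ≥ 3`. [folklore] -/
theorem twentyfour_le_finrank [IsGalois ℚ F] {ζ : ZMod 2} (D : QuarticInversion.Datum (GalT F) conjT (ZMod m) ζ) (h3 : 3 ≤ m) :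
    24 ≤ Module.finrank ℚ F := by
  rw [finrank_eq_eight_mul D]; omega

/-- **The quartic inversion datum from an `Aut`-datum.**  An injective multiplicative-to-additive `ι₀ : ℤ/2 × ℤ/m → Aut(F)` whose `ι₀ (1,0)`
induces complex conjugation at `σ₀`, automorphisms `y₀ ∉ ι₀(H₀)`, `t₀ ∉ ι₀(H₀) ∪ y₀ ι₀(H₀)` with `y₀ ι₀ a = ι₀(−a) y₀`, `y₀² = ι₀ (ζ,0)`,
`t₀ ι₀ a = ι₀ a t₀`, `t₀² = ι₀ (1,0)`, `y₀ t₀ = ι₀(1,0) t₀ y₀`, in a field of degree `8m`, give a datum on `GalT F` through `galTOfAut σ₀`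
(exhaustion by counting, `QuarticInversion.exhaust_of_card`). [folklore] -/
theorem exists_datum_of_aut [IsGalois ℚ F] {ζ : ZMod 2} (σ₀ : F →+* ℂ) (ι₀ : ZMod 2 × ZMod m → (F ≃ₐ[ℚ] F)) (y₀ t₀ : F ≃ₐ[ℚ] F)
    (hι : ∀ a b, ι₀ (a + b) = ι₀ a * ι₀ b) (hcσ : σ₀.comp ((ι₀ (1, 0) : F ≃ₐ[ℚ] F) : F →+* F) = conjugate σ₀)
    (hy : ∀ a, y₀ * ι₀ a = ι₀ (-a) * y₀) (hyy : y₀ * y₀ = ι₀ (ζ, 0)) (ht : ∀ a, t₀ * ι₀ a = ι₀ a * t₀) (htt : t₀ * t₀ = ι₀ (1, 0))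
    (hyt : y₀ * t₀ = ι₀ (1, 0) * t₀ * y₀) (hinj : Function.Injective ι₀) (hy_ne : ∀ a, y₀ ≠ ι₀ a) (ht_ne : ∀ a, t₀ ≠ ι₀ a)
    (hty_ne : ∀ a, t₀ ≠ y₀ * ι₀ a) (hcard : Module.finrank ℚ F = 8 * m) :
    Nonempty (QuarticInversion.Datum (GalT F) conjT (ZMod m) ζ) := by
  have hinj' : Function.Injective fun a => galTOfAut σ₀ (ι₀ a) := fun a b h => hinj ((galTOfAut σ₀).injective h)
  have hmul : ∀ a b, galTOfAut σ₀ (ι₀ (a + b)) = galTOfAut σ₀ (ι₀ a) * galTOfAut σ₀ (ι₀ b) := fun a b => by rw [hι, galTOfAut_mul]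
  have hy' : ∀ a, galTOfAut σ₀ y₀ * galTOfAut σ₀ (ι₀ a) = galTOfAut σ₀ (ι₀ (-a)) * galTOfAut σ₀ y₀ := fun a => by
    rw [← galTOfAut_mul, ← galTOfAut_mul, hy]
  have hyy' : galTOfAut σ₀ y₀ * galTOfAut σ₀ y₀ = galTOfAut σ₀ (ι₀ (ζ, 0)) := by rw [← galTOfAut_mul, hyy]
  have hyne : ∀ a, galTOfAut σ₀ y₀ ≠ galTOfAut σ₀ (ι₀ a) := fun a h => hy_ne a ((galTOfAut σ₀).injective h)
  have htne : ∀ a, galTOfAut σ₀ t₀ ≠ galTOfAut σ₀ (ι₀ a) := fun a h => ht_ne a ((galTOfAut σ₀).injective h)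
  have htyne : ∀ a, galTOfAut σ₀ t₀ ≠ galTOfAut σ₀ y₀ * galTOfAut σ₀ (ι₀ a) := fun a h => by
    rw [← galTOfAut_mul] at h; exact hty_ne a ((galTOfAut σ₀).injective h)
  exact ⟨{ ι := fun a => galTOfAut σ₀ (ι₀ a)
           y := galTOfAut σ₀ y₀
           t := galTOfAut σ₀ t₀
           map_add := hmul
           map_c := galTOfAut_conjAut σ₀ hcσ
           y_mul := hy'
           y_mul_y := hyy'
           t_mul := fun a => by
             show galTOfAut σ₀ t₀ * galTOfAut σ₀ (ι₀ a) = galTOfAut σ₀ (ι₀ a) * galTOfAut σ₀ t₀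
             rw [← galTOfAut_mul, ← galTOfAut_mul, ht]
           t_mul_t := by rw [← galTOfAut_mul, htt, galTOfAut_conjAut σ₀ hcσ]
           y_mul_t := by
             rw [← galTOfAut_conjAut σ₀ hcσ, ← galTOfAut_mul, ← galTOfAut_mul, ← galTOfAut_mul, hyt]
           inj := hinj'
           y_ne := hyne
           t_ne := htne
           t_ne' := htyne
           exhaust := QuarticInversion.exhaust_of_card _ _ _ hmul hinj' hy' hyy' hyne htne htyne
             (by rw [FaceCensus.card_galT, hcard, ZMod.card]) }⟩

end Field

/-! ## §3 The Hodge-conjecture reading through the INT2-GEN socket (conditional on the face periods) -/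

variable {m : ℕ} [NeZero m]

/-- **HC for the slice of a Galois CM field of dicyclic quartic type (`ζ = 1`) from `β` face periods** (INT2-GEN socket BY NAME; CONDITIONAL on
the periods — `HC_CM` is NOT proved): for `K` Galois CM with a quartic inversion datum on `GalT K` over `ℤ/m` (`m` odd `≥ 3`, `ζ = 1`) there is a
face set `𝒮` with `|𝒮| = β(K)` (none fewer can satisfy the generation binder) such that, if every face of `𝒮` has a non-vanishing period on the
universe of record, the Hodge conjecture holds for every abelian variety dominated by a product of CM abelian varieties with CM by subfields of `K`.
[cite: Shimura1998, §6.2 Theorem 3 and §6.1 Corollary of Theorem 2 (pp. 41–43)] [cite: Pohlmann1968, Thm. 1]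
[cite: Milne1999LefschetzClasses, Thm. 3.2 and Cor. 4.5] [cite: MumfordAV1970, §19 Thm. 1 and p. 169] -/
theorem hodgeConjectureFor_of_quartic_one_of_exists_facePeriod (K : CMField) [hGal : IsGalois ℚ K]
    (D : QuarticInversion.Datum (GalT K) conjT (ZMod m) 1) (hm : Odd m) (h3 : 3 ≤ m) (σ₀ : (K : Type) →+* ℂ) :
    ∃ 𝒮 : Finset (Face K), 𝒮.card = Fintype.card (Block (conjT : GalT K)) ∧
      ((∀ f ∈ 𝒮, ∃ ι₁ : K →+* ℂ, f.Admissible ι₁ ∧ ∃ (V : HermSpace3 K ι₁) (σ : K →+* ℂ),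
        (Model.picardCMUniverse exists_isReal_hodgeModel_holds hodgePQ_independent_of_hodgeModel_holds
          BallQuotient.ballQuotientUniformised_holds cmAbelianVarietyRealised_holds).PeriodNV ι₁ V K f.psi σ) →
      ∀ {P B : AbelianVariety ℂ}, AbelianVariety.IsProductOf (fun B : AbelianVariety ℂ =>
        ∃ (E : Type) (_ : Field E) (_ : NumberField E) (_ : IsCMField E) (_ : E →+* (K : Type)) (Φ : CMType E)
          (ι : 𝓞 E →+* End B) (ϑ : E →+* Module.End ℂ (complexBetti B.X 1)),
          IsCMTypeRealisation Φ B ι ϑ) P →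
      AVDominatedBy B P → HodgeConjectureFor B.dim B.X) := by
  obtain ⟨𝒮, hcard, hgen⟩ := exists_faces_hgen_of_quartic_one (F := K) D hm h3 σ₀
  refine ⟨𝒮, hcard, fun h P B hP hB => ?_⟩
  have h6 : 6 ≤ Module.finrank ℚ K := le_trans (by norm_num) (twentyfour_le_finrank (F := K) D h3)
  exact hodgeConjectureFor_of_avDominatedBy_isProductOf_of_exists_facePeriod_on K h6 (𝒮 : Set (Face K)) σ₀ hgen
    (fun f hf => h f (Finset.mem_coe.mp hf)) hP hB

/-- **HC for the slice of a Galois CM field of dihedral quartic type (`ζ = 0`) from `β − 2` face periods** (INT2-GEN socket BY NAME;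
CONDITIONAL on the periods — `HC_CM` is NOT proved).
[cite: Shimura1998, §6.2 Theorem 3 and §6.1 Corollary of Theorem 2 (pp. 41–43)] [cite: Pohlmann1968, Thm. 1]
[cite: Milne1999LefschetzClasses, Thm. 3.2 and Cor. 4.5] [cite: MumfordAV1970, §19 Thm. 1 and p. 169] -/
theorem hodgeConjectureFor_of_quartic_zero_of_exists_facePeriod (K : CMField) [hGal : IsGalois ℚ K]
    (D : QuarticInversion.Datum (GalT K) conjT (ZMod m) 0) (hm : Odd m) (h3 : 3 ≤ m) (σ₀ : (K : Type) →+* ℂ) :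
    ∃ 𝒮 : Finset (Face K), 𝒮.card + 2 = Fintype.card (Block (conjT : GalT K)) ∧
      ((∀ f ∈ 𝒮, ∃ ι₁ : K →+* ℂ, f.Admissible ι₁ ∧ ∃ (V : HermSpace3 K ι₁) (σ : K →+* ℂ),
        (Model.picardCMUniverse exists_isReal_hodgeModel_holds hodgePQ_independent_of_hodgeModel_holds
          BallQuotient.ballQuotientUniformised_holds cmAbelianVarietyRealised_holds).PeriodNV ι₁ V K f.psi σ) →
      ∀ {P B : AbelianVariety ℂ}, AbelianVariety.IsProductOf (fun B : AbelianVariety ℂ =>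
        ∃ (E : Type) (_ : Field E) (_ : NumberField E) (_ : IsCMField E) (_ : E →+* (K : Type)) (Φ : CMType E)
          (ι : 𝓞 E →+* End B) (ϑ : E →+* Module.End ℂ (complexBetti B.X 1)),
          IsCMTypeRealisation Φ B ι ϑ) P →
      AVDominatedBy B P → HodgeConjectureFor B.dim B.X) := by
  obtain ⟨𝒮, hcard, hgen⟩ := exists_faces_hgen_of_quartic_zero (F := K) D hm h3 σ₀
  refine ⟨𝒮, hcard, fun h P B hP hB => ?_⟩
  have h6 : 6 ≤ Module.finrank ℚ K := le_trans (by norm_num) (twentyfour_le_finrank (F := K) D h3)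
  exact hodgeConjectureFor_of_avDominatedBy_isProductOf_of_exists_facePeriod_on K h6 (𝒮 : Set (Face K)) σ₀ hgen
    (fun f hf => h f (Finset.mem_coe.mp hf)) hP hB

end Summit.HodgeConjecture.CorCM.FaceQuarticInversion

end
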